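import Summits.ResolutionOfSingularities.ResolutionOfSingularities.Theorems.SplitTowerStage

/-!
# MaxContactCut / SplitTower (main) — ENGINE (SE) `SplitCut.SplitConeExit` PROVED with no hypothesis; the landed
thirteen-engine corollary `NearExit.cuspGenericRung_of_engines` with the binder `hSE : SplitConeExit` DISCHARGED
(twelve engine binders left)

Node «SplitTower» of cell `decomp-res-lens-2` (RESIDUAL MODE, lens «structural dichotomy (special vs generic)», g34,
critic letter 228d), by-name target `MaxContactCut.RungOne` via the landed `CuspX.closes : CuspX.CuspGenericRung →
CuspX.CuspSpecialRung → MaxContactCut.RungOne` and `NearExit.cuspGenericRung_of_engines` (13 engine binders).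

THE LETTER.  `SplitCut.SplitConeExit`: on a regular scheme `Y`, a curve `cl{η}` (`IsCurvePt η`) at each of whose closed
points `y` the ideal is principal `𝓘_y = (f)` with the SPLIT-CONE FRAME `f = splitCone c₀ c₁ G n + ε c₂ᵏ + h`
(`(c₀, c₁, c₂) = 𝔓` the curve prime, `(c, v) = 𝔪_y` of embedding dimension `4`, `G 0 = 1`, `MiddleCoeff`, `VertexTame`,
`ε` a unit, `h ∈ WtIdeal c n k (nk + 1)`, `n ≤ k`, `n ∤ k`, `BinomGuard`) has an exit package over `{y | η ⤳ y}`: a weakly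
admissible sequence of regular centres over the curve after which Hironaka's `τ ≥ 2` at every order-`n` point over it.

THE MECHANISM (special vs generic).  (1) THE SPLIT SHAPE (slice `SplitTowerShape`, `structure SplitShape J P n k` over a
local ring: an rsop-part `c = (c₀, c₁, c₂)` spanning the prime `P`, `(c, w) = 𝔪`, `J = (f)` with the frame above and the
unit/core dichotomy of the middle coefficients carried as data) is STABLE under the blow-up of `P`: in the chart family
of the blow-up at a closed point (slices `SplitTowerChartZU`, `SplitTowerGen`, `SplitTowerChartW`) every point of the
fibre is resolved or of order `< n` or has `τ ≥ 2` (`SplitShape.closed_law`: the GENERIC FIBRE LAW — a binary form all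
of whose chart dehomogenisations lie in `n`-th powers of maximal ideals of `κ[T]` is an `n`-th power of a linear form
over a field extension (slice `SplitTowerPoly`), against `NotPow` from the guard and a middle unit or, at core points,
the SPECIAL FIBRE LAW on the fibre line (slice `SplitTowerAlg`, Matsumura 17.10 and the graded directrix count) —
EXCEPT the `c₂`-chart origin `𝔴₀`, where the shape REPRODUCES with weight `k - n` along the new prime
`𝔓₁ = (c₀/c₂, c₁/c₂, c₂)` (`SplitShape.origin`).  (2) THE GENERIC ORIGIN: the prime `originP = (e₀, e₁) + 𝔓·B₂` of the
`c₂`-chart ring is the ONLY point over the generic point `ζ` of the curve at which the controlled transform has order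
`≥ n` (`SplitShape.generic_chart`, slice `SplitTowerGen`: `NotPow` over `Frac(A/P)` (slice `SplitTowerEta`, both
characteristic branches — this is where `VertexTame`, `e ≤ j` and the guard are load-bearing) and the generic fibre law
read through `chartQuot`), so the new curve point `ζ₁ = q₂ 𝔴̃₀` is INDEPENDENT of the closed point and the chart family
used to construct it (`eq_originPt`, slice `SplitTowerPoint`), specialises exactly to the `c₂`-origins over the closed
points (`exists_origin_of_originPt_specializes`, via `ChartFamily.lift`) and carries the shape of weight `k - n` along
`curvePrime` (`shape_of_originPt_specializes`); every other order-`n` point over the curve has `τ ≥ 2`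
(`tau_of_not_specializes`).  (3) THE TOWER (slice `SplitTowerStage`, `splitStage`, strong induction on `k`): blow up the
regular curve `cl{ζ}` (regular since `A/P` is regular at closed points and a field at `ζ`; inside `supp(𝓘, n)` since
`J ⊆ Pⁿ` at a closed point generises to `J_ζ ⊆ 𝔪_ζⁿ`), track `ζ₁`, recurse with `k - n`; when `k - n < n` stop: over `ζ`
nothing has order `n` (`exit_generic`), over closed points `τ ≥ 2` (`exit_closed`), off the curve order and `τ` are
transported (`IsBlowup.stalkTau_controlledTransform_of_not_mem`).  The chart families (slice `SplitTowerCharts`,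
`structure ChartFamily`: the Rees charts `q_j : Spec B_j → Y₁` over `Spec 𝒪_y → Y` with stalk isomorphisms, covering the
points over the generisations of `y`, with the lifting property for specialisations) replace point-by-point chart
choices, so that NO semicontinuity of `τ`, NO properness and NO closedness hypotheses enter.

Slices: `SplitTowerAlg` · `SplitTowerPoly` · `SplitTowerShape` · `SplitTowerQuot` · `SplitTowerEta` · `SplitTowerChartZU` ·
`SplitTowerGen` · `SplitTowerChartW` · `SplitTowerCharts` · `SplitTowerFrame` · `SplitTowerPoint` · `SplitTowerStage` · this
file (§M the main theorem, §C corollaries).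
Sources: [Hironaka1964] Ch. III; [CossartJannsenSaito2020] Ch. 2, 8, 9; [CossartPiltant2008] §4; [CutkoskyBook2004] §7;
[Matsumura1987] Thms. 14.2, 16.2, 17.10; [StacksProject, Tags 01HR, 080U, 0AGS].
-/

noncomputable section

open CategoryTheory AlgebraicGeometry TopologicalSpace Topology IsLocalRing
open Literature.AlgebraicGeometry.Resolution
open Summit.ResolutionOfSingularities.ResolutionOfSingularities.Theorems
open Summit.ResolutionOfSingularities.ResolutionOfSingularities.Theorems.WeakOrderReduction
open Summit.ResolutionOfSingularities.ResolutionOfSingularities.Theorems.RelativeDeltaCut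
open Summit.ResolutionOfSingularities.ResolutionOfSingularities.Theorems.SplitCut

namespace Summit.ResolutionOfSingularities.ResolutionOfSingularities.Theorems.SplitTower

/-! ## §M  The main theorem -/

section SchemeLevel

/-- **ENGINE (SE) WITH NO HYPOTHESIS.**  `SplitCut.SplitConeExit` holds: the split-cone tower `splitStage` started at
the curve `cl{η}` with the split shapes read off `IsSplitConeAt` at the closed points of the curve
(`splitShape_of_isSplitConeAt`). [cite: CossartJannsenSaito2020, Ch. 2] [cite: Hironaka1964] -/
theorem splitConeExit_holds : SplitConeExit := by
  intro Y hY I n hn k η hU hLN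
  obtain ⟨hcurve, hcone⟩ := hU
  haveI : IsLocallyNoetherian Y := hLN
  -- a closed point of the curve
  obtain ⟨y₀, hy₀, hy₀η⟩ : ∃ y₀ : Y, η ⤳ y₀ ∧ y₀ ≠ η := by
    by_contra hcon
    push Not at hcon
    refine hcurve.1 ?_
    have hcl : closure ({η} : Set Y) = {η} := by
      refine Set.Subset.antisymm (fun y hy => ?_) subset_closure
      exact hcon y (specializes_iff_mem_closure.mpr hy)
    rw [← hcl]
    exact isClosed_closure
  -- the split shapes at the proper specialisations of `η` (all closed, `IsCurvePt`)
  have hI1 : ∀ (y : Y) (h : η ⤳ y), y ≠ η →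
      Nonempty (SplitShape (stalkIdeal (⟨I, [], n⟩ : MarkedIdeal Y).ideal y) (curvePrime h)
        (⟨I, [], n⟩ : MarkedIdeal Y).mult k) := by
    intro y h hne
    obtain ⟨h', -, hD⟩ := splitShape_of_isSplitConeAt hY I (hcone y h (hcurve.2 y h hne))
    exact hD
  have hnk : n ≤ k := by
    obtain ⟨-, hnk, -⟩ := splitShape_of_isSplitConeAt hY I (hcone y₀ hy₀ (hcurve.2 y₀ hy₀ hy₀η))
    exact hnk
  -- run the split-cone tower
  obtain ⟨s, hwa, hco, hT, hexit⟩ := splitStage k hY ⟨I, [], n⟩ {y | η ⤳ y} η hn hnk (fun y h => h)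
    ⟨y₀, hy₀, hy₀η⟩ hI1 (fun x hx hns _ => absurd hx hns)
  exact ⟨s, hwa, hco, hT, fun x hx hord => hexit x hx (le_of_eq hord.symm)⟩

/-- Fully qualified restatement of the letter (probe: the tree definition, unedited). [folklore] -/
example : Summit.ResolutionOfSingularities.ResolutionOfSingularities.Theorems.SplitCut.SplitConeExit :=
  splitConeExit_holds

end SchemeLevel

/-! ## §C  DISCHARGE COROLLARY: the landed thirteen-engine corollary `NearExit.cuspGenericRung_of_engines` with the
binder `hSE : SplitConeExit` removed BY NAME (twelve engine binders left) -/

section Corollaries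

open Summit.ResolutionOfSingularities.ResolutionOfSingularities.Theorems.DeltaFaceCutClasses
open Summit.ResolutionOfSingularities.ResolutionOfSingularities.Theorems.FaceFormCutClasses
open Summit.ResolutionOfSingularities.ResolutionOfSingularities.Theorems.CurveLeafExit
open Summit.ResolutionOfSingularities.ResolutionOfSingularities.Theorems.PinchCut
open Summit.ResolutionOfSingularities.ResolutionOfSingularities.Theorems.JetCut
open Summit.ResolutionOfSingularities.ResolutionOfSingularities.Theorems.PurityCut
open Summit.ResolutionOfSingularities.ResolutionOfSingularities.Theorems.CylinderCut
open Summit.ResolutionOfSingularities.ResolutionOfSingularities.Theorems.CrossCut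
open Summit.ResolutionOfSingularities.ResolutionOfSingularities.Theorems.DeepCrossCut
open Summit.ResolutionOfSingularities.ResolutionOfSingularities.Theorems.OddCrossCut
open Summit.ResolutionOfSingularities.ResolutionOfSingularities.Theorems.CuspCut
open Summit.ResolutionOfSingularities.ResolutionOfSingularities.Theses

/-- **`CuspX.CuspGenericRung` from TWELVE engines**: `NearExit.cuspGenericRung_of_engines` with `hSE` discharged by
`splitConeExit_holds`. [folklore] -/
theorem cuspGenericRung_of_engines (hD : DeltaPackageExit) (hU : UniformCurvePackageExit) (hR : RelCurvePackageExit)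
    (hGE : GrandExit) (hJE : JetCylinderExit)
    (hX : MaxContactCut.MaxOrderThreefoldResolution) (hXE : CrossExit) (hDXE : DeepCrossExit) (hNE : NodeExit)
    (hOXE : OddCrossExit) (hCuE : CuspExit) (hTaE : TameTwoExit) : CuspX.CuspGenericRung :=
  NearExit.cuspGenericRung_of_engines hD hU hR hGE splitConeExit_holds hJE hX hXE hDXE hNE hOXE hCuE hTaE

/-- **`MaxContactCut.RungOne` BY NAME from twelve engines and the located residual `CuspX.CuspSpecialRung`**
(`CuspX.closes`, cited, not re-landed). [folklore] -/
theorem closes_of_engines (hD : DeltaPackageExit) (hU : UniformCurvePackageExit) (hR : RelCurvePackageExit)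
    (hGE : GrandExit) (hJE : JetCylinderExit)
    (hX : MaxContactCut.MaxOrderThreefoldResolution) (hXE : CrossExit) (hDXE : DeepCrossExit) (hNE : NodeExit)
    (hOXE : OddCrossExit) (hCuE : CuspExit) (hTaE : TameTwoExit) (hS : CuspX.CuspSpecialRung) :
    MaxContactCut.RungOne :=
  CuspX.closes (cuspGenericRung_of_engines hD hU hR hGE hJE hX hXE hDXE hNE hOXE hCuE hTaE) hS

end Corollaries

end Summit.ResolutionOfSingularities.ResolutionOfSingularities.Theorems.SplitTower

end
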